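import Literature.Barriers.NavierStokesRegularity.NavierStokesInequalityProfileSlices
import HarnessLib

/-!
# Scheffer's block from planar profiles, III: kinematics of the field of the block

Barrier catalogue support file for `NavierStokesRegularity` (D-0021), on the proof path of fact
D-I `Literature.Barriers.NavierStokesRegularity.NSIBlock_of_profiles`
(`NavierStokesInequalityProfiles`; V. Scheffer, Comm. Math. Phys. 101 (1985), Lemma 2.1;
W. S. Ożański, arXiv:1709.00602v4, §4.1–4.2, Prop. 4.2). For profile data
`(η, δ, Cᵢ, aᵢ, Qᵢ)` adapted to a geometric arrangement (`IsNSIProfileData`, `IsNSIArrangement`)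
the field of the block is `u(t) = u¹(t) + u²(t)`, `uⁱ(t) = u[aᵢ(t)vᵢ, Qᵢ(t)]` (`profileField`,
Ożański (4.17); Scheffer (2.10)). This file proves the KINEMATIC half of the claims of
Proposition 4.2 / Lemma 2.1 — everything in `IsNSIBlock` except the Navier–Stokes inequality
itself — for `t` in the open slab `J = (-η, T+η)`:

* `swirlField_eq_zero_or` — the two summands have disjoint supports (Scheffer (2.13):
  `R(C₁) ∩ R(C₂) = ∅`), whence
* `norm_profileField`, `norm_sq_profileField` — **`|u(x,t)| = (Q₁(t) + Q₂(t))(R⁻¹x)`**,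
  `|u|² = (Q₁² + Q₂²) ∘ R⁻¹` (Ożański (3.11) with Prop. 4.2 (ii); Scheffer (2.23));
* `tsupport_profileField` — **`supp u(t) = G = R(Ū₁ ∪ Ū₂)`** (Prop. 4.2 (i); Scheffer (2.12));
* `isDivFree_profileField` — **`div u(t) = 0`** (Lemma 3.1 (i); Scheffer (2.24));
* `gain_profileField` — **`|u(Γx, T)| ≥ τ⁻¹|u(x,0)|`** for all `x` (the gain (2.2) of a block,
  from the profile gain, Ożański (4.11) with Prop. 4.2 (ii), p. 16);
* `exists_profileField_zero_ne_zero` — `u(·,0) ≢ 0` (`U₁ ≠ ∅`, `Q₁(0) = f₁ > 0` on `U₁`);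
* `timeDeriv_norm_sq_profileField` — **`∂ₜ|u|²(x,t) = ∂ₜ(Q₁²)(R⁻¹x,t) + ∂ₜ(Q₂²)(R⁻¹x,t)`**
  (Scheffer (2.23): `∂ₜ|u|² = ∂ₜ(q²ᵢ,ₜ) ∘ R⁻¹`; Ożański §4.2: "the NSI becomes `∂ₜq²ᵢ ≤ …`"),
  with `deriv_Q₁_sq_eq_zero`/`deriv_Q₂_sq_eq_zero` off `Ūᵢ`;
* the localisations `profileField_eventuallyEq_left/right` (near a point over `Ū₁` the field
  is `u¹`, Scheffer (2.13)–(2.14)) used for the Laplacian and the pressure gradient downstream.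

## References

* V. Scheffer, *A solution to the Navier–Stokes inequality with an internal singularity*,
  Comm. Math. Phys. 101 (1985), 47–85: Lemma 2.1, (2.10)–(2.14), (2.23)–(2.24). [`Scheffer1985`]
* W. S. Ożański, arXiv:1709.00602v4, §3.3 (3.11), Lemma 3.1 (i), §4.1 (4.17)–(4.19), Prop. 4.2
  (i)–(ii), §4.2 (first paragraph). [`Ozanski2017NSISingular`]
-/

noncomputable section

open MeasureTheory Set Function Filter Topology TopologicalSpace WithLp Metric
open scoped ENNReal InnerProductSpace RealInnerProductSpace ContDiff Laplacian

namespace Literature.Barriers.NavierStokesRegularity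

open Literature.Analysis.FluidPDE

namespace IsNSIProfileData

variable {U₁ U₂ : Set (ℝ × ℝ)} {v₁ : ℝ × ℝ → ℝ × ℝ} {f₁ φ₁ : ℝ × ℝ → ℝ} {v₂ : ℝ × ℝ → ℝ × ℝ}
  {f₂ φ₂ : ℝ × ℝ → ℝ} {T τ : ℝ} {z : EuclideanSpace ℝ (Fin 3)} {η δ : ℝ} {C₁ C₂ : Set (ℝ × ℝ)}
  {a₁ a₂ : ℝ → ℝ} {Q₁ Q₂ : ℝ → ℝ × ℝ → ℝ}

/-! ### Disjointness of the two summands -/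

/-- `0 ∈ J`. [folklore] -/
theorem zero_mem (h : IsNSIProfileData U₁ U₂ v₁ v₂ f₁ f₂ T τ z η δ C₁ C₂ a₁ a₂ Q₁ Q₂)
    (hA : IsNSIArrangement U₁ U₂ v₁ f₁ φ₁ v₂ f₂ φ₂ T τ z) : (0 : ℝ) ∈ Ioo (-η) (T + η) :=
  h.Icc_subset ⟨le_rfl, hA.T_pos.le⟩

/-- `T ∈ J`. [folklore] -/
theorem T_mem (h : IsNSIProfileData U₁ U₂ v₁ v₂ f₁ f₂ T τ z η δ C₁ C₂ a₁ a₂ Q₁ Q₂)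
    (hA : IsNSIArrangement U₁ U₂ v₁ f₁ φ₁ v₂ f₂ φ₂ T τ z) : T ∈ Ioo (-η) (T + η) :=
  h.Icc_subset ⟨hA.T_pos.le, le_rfl⟩

/-- `Q₂(t) = 0` off `Ū₂`, in particular on `Ū₁` (Scheffer (2.4), (2.13)).
[cite: Scheffer1985, Lemma 2.1 (2.4) and (2.13)] -/
theorem Q₂_eq_zero_of_mem_closure
    (h : IsNSIProfileData U₁ U₂ v₁ v₂ f₁ f₂ T τ z η δ C₁ C₂ a₁ a₂ Q₁ Q₂)
    (hA : IsNSIArrangement U₁ U₂ v₁ f₁ φ₁ v₂ f₂ φ₂ T τ z) {t : ℝ} (ht : t ∈ Ioo (-η) (T + η))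
    {q : ℝ × ℝ} (hq : q ∈ closure U₁) : Q₂ t q = 0 :=
  h.Q₂_eq_zero t ht q (Set.disjoint_left.1 hA.disjoint hq)

/-- `Q₁(t) = 0` on `Ū₂`. [cite: Scheffer1985, Lemma 2.1 (2.4) and (2.13)] -/
theorem Q₁_eq_zero_of_mem_closure
    (h : IsNSIProfileData U₁ U₂ v₁ v₂ f₁ f₂ T τ z η δ C₁ C₂ a₁ a₂ Q₁ Q₂)
    (hA : IsNSIArrangement U₁ U₂ v₁ f₁ φ₁ v₂ f₂ φ₂ T τ z) {t : ℝ} (ht : t ∈ Ioo (-η) (T + η))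
    {q : ℝ × ℝ} (hq : q ∈ closure U₂) : Q₁ t q = 0 :=
  h.Q₁_eq_zero t ht q (Set.disjoint_right.1 hA.disjoint hq)

/-- **The two summands have disjoint supports**: at every point one of `u¹(t)`, `u²(t)` vanishes
(Scheffer (2.13): `R(C₁) ∩ R(C₂) = ∅`; Ożański: `Ū₁ ∩ Ū₂ = ∅`).
[cite: Scheffer1985, Lemma 2.1 (2.12)–(2.13)] -/
theorem swirlField_eq_zero_or (h : IsNSIProfileData U₁ U₂ v₁ v₂ f₁ f₂ T τ z η δ C₁ C₂ a₁ a₂ Q₁ Q₂)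
    (hA : IsNSIArrangement U₁ U₂ v₁ f₁ φ₁ v₂ f₂ φ₂ T τ z) {t : ℝ} (ht : t ∈ Ioo (-η) (T + η))
    (y : EuclideanSpace ℝ (Fin 3)) :
    swirlField (a₁ t • v₁) (Q₁ t) y = 0 ∨ swirlField (a₂ t • v₂) (Q₂ t) y = 0 := by
  by_cases hy : meridian y ∈ closure U₁
  · exact Or.inr ((h.slice₂ hA ht).swirlField_eq_zero (Set.disjoint_left.1 hA.disjoint hy))
  · exact Or.inl ((h.slice₁ hA ht).swirlField_eq_zero hy)

/-- The field of the block as a sum of functions. [folklore] -/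
theorem profileField_eq_add (t : ℝ) :
    profileField v₁ v₂ a₁ a₂ Q₁ Q₂ t =
      swirlField (a₁ t • v₁) (Q₁ t) + swirlField (a₂ t • v₂) (Q₂ t) := rfl

/-- Each slice `u(t)`, `t ∈ J`, is smooth. [cite: Scheffer1985, Lemma 2.1 (2.12)] -/
theorem contDiff_profileField (h : IsNSIProfileData U₁ U₂ v₁ v₂ f₁ f₂ T τ z η δ C₁ C₂ a₁ a₂ Q₁ Q₂)
    (hA : IsNSIArrangement U₁ U₂ v₁ f₁ φ₁ v₂ f₂ φ₂ T τ z) {t : ℝ} (ht : t ∈ Ioo (-η) (T + η)) :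
    ContDiff ℝ ∞ (profileField v₁ v₂ a₁ a₂ Q₁ Q₂ t) :=
  (h.slice₁ hA ht).contDiff_swirlField.add (h.slice₂ hA ht).contDiff_swirlField

/-! ### `|u| = (Q₁ + Q₂) ∘ R⁻¹` and the support -/

/-- **`|u(x,t)| = Q₁(t)(R⁻¹x) + Q₂(t)(R⁻¹x)`** for `t ∈ J` (one of the two terms vanishes at each
point; Ożański (3.11) `|u[v,f]| = f`, Prop. 4.2 (ii); Scheffer (2.23)).
[cite: Ozanski2017NSISingular, §3.3 (3.11) and Prop. 4.2 (ii)] -/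
theorem norm_profileField (h : IsNSIProfileData U₁ U₂ v₁ v₂ f₁ f₂ T τ z η δ C₁ C₂ a₁ a₂ Q₁ Q₂)
    (hA : IsNSIArrangement U₁ U₂ v₁ f₁ φ₁ v₂ f₂ φ₂ T τ z) {t : ℝ} (ht : t ∈ Ioo (-η) (T + η))
    (x : EuclideanSpace ℝ (Fin 3)) :
    ‖profileField v₁ v₂ a₁ a₂ Q₁ Q₂ t x‖ = Q₁ t (meridian x) + Q₂ t (meridian x) := by
  have h1 := (h.slice₁ hA ht).norm_swirlField_eq x
  have h2 := (h.slice₂ hA ht).norm_swirlField_eq x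
  rw [profileField_apply]
  rcases h.swirlField_eq_zero_or hA ht x with h0 | h0
  · rw [h0, zero_add, h2, ← h1, h0, norm_zero, zero_add]
  · rw [h0, add_zero, h1, ← h2, h0, norm_zero, add_zero]

/-- **`|u(x,t)|² = Q₁(t)(R⁻¹x)² + Q₂(t)(R⁻¹x)²`** for `t ∈ J` (Scheffer (2.23):
`|u|² = q²ᵢ,ₜ ∘ R⁻¹` on `R(Cᵢ)`). [cite: Scheffer1985, Lemma 2.1 (2.23)] -/
theorem norm_sq_profileField (h : IsNSIProfileData U₁ U₂ v₁ v₂ f₁ f₂ T τ z η δ C₁ C₂ a₁ a₂ Q₁ Q₂)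
    (hA : IsNSIArrangement U₁ U₂ v₁ f₁ φ₁ v₂ f₂ φ₂ T τ z) {t : ℝ} (ht : t ∈ Ioo (-η) (T + η))
    (x : EuclideanSpace ℝ (Fin 3)) :
    ‖profileField v₁ v₂ a₁ a₂ Q₁ Q₂ t x‖ ^ 2 = Q₁ t (meridian x) ^ 2 + Q₂ t (meridian x) ^ 2 := by
  have h1 := (h.slice₁ hA ht).norm_swirlField_eq x
  have h2 := (h.slice₂ hA ht).norm_swirlField_eq x
  rw [profileField_apply]
  rcases h.swirlField_eq_zero_or hA ht x with h0 | h0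
  · rw [h0, zero_add, h2, ← h1, h0, norm_zero]
    ring
  · rw [h0, add_zero, h1, ← h2, h0, norm_zero]
    ring

/-- The support of `u(t)` is the union of the supports of the summands. [folklore] -/
theorem support_profileField (h : IsNSIProfileData U₁ U₂ v₁ v₂ f₁ f₂ T τ z η δ C₁ C₂ a₁ a₂ Q₁ Q₂)
    (hA : IsNSIArrangement U₁ U₂ v₁ f₁ φ₁ v₂ f₂ φ₂ T τ z) {t : ℝ} (ht : t ∈ Ioo (-η) (T + η)) :
    support (profileField v₁ v₂ a₁ a₂ Q₁ Q₂ t) =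
      support (swirlField (a₁ t • v₁) (Q₁ t)) ∪ support (swirlField (a₂ t • v₂) (Q₂ t)) := by
  ext y
  simp only [mem_support, mem_union, profileField_apply, ne_eq]
  rcases h.swirlField_eq_zero_or hA ht y with h0 | h0 <;> simp [h0]

/-- **`supp u(t) = G = R(Ū₁ ∪ Ū₂)`** for `t ∈ J` (Ożański Prop. 4.2 (i); Scheffer (2.12)).
[cite: Ozanski2017NSISingular, Prop. 4.2 (i)] [cite: Scheffer1985, Lemma 2.1 (2.12)] -/
theorem tsupport_profileField (h : IsNSIProfileData U₁ U₂ v₁ v₂ f₁ f₂ T τ z η δ C₁ C₂ a₁ a₂ Q₁ Q₂)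
    (hA : IsNSIArrangement U₁ U₂ v₁ f₁ φ₁ v₂ f₂ φ₂ T τ z) {t : ℝ} (ht : t ∈ Ioo (-η) (T + η)) :
    tsupport (profileField v₁ v₂ a₁ a₂ Q₁ Q₂ t) = revolve (closure U₁ ∪ closure U₂) := by
  rw [tsupport, h.support_profileField hA ht, closure_union]
  change tsupport _ ∪ tsupport _ = _
  rw [(h.slice₁ hA ht).tsupport_swirlField, (h.slice₂ hA ht).tsupport_swirlField, revolve, revolve,
    revolve, preimage_union]

/-- `u(t)` has compact support. [cite: Scheffer1985, Lemma 2.1 (2.12)] -/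
theorem hasCompactSupport_profileField
    (h : IsNSIProfileData U₁ U₂ v₁ v₂ f₁ f₂ T τ z η δ C₁ C₂ a₁ a₂ Q₁ Q₂)
    (hA : IsNSIArrangement U₁ U₂ v₁ f₁ φ₁ v₂ f₂ φ₂ T τ z) {t : ℝ} (ht : t ∈ Ioo (-η) (T + η)) :
    HasCompactSupport (profileField v₁ v₂ a₁ a₂ Q₁ Q₂ t) := by
  rw [HasCompactSupport, h.tsupport_profileField hA ht]
  exact hA.isCompact_revolve

/-- `u(t) = 0` off `G`. [cite: Scheffer1985, Lemma 2.1 (2.12)] -/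
theorem profileField_eq_zero (h : IsNSIProfileData U₁ U₂ v₁ v₂ f₁ f₂ T τ z η δ C₁ C₂ a₁ a₂ Q₁ Q₂)
    (hA : IsNSIArrangement U₁ U₂ v₁ f₁ φ₁ v₂ f₂ φ₂ T τ z) {t : ℝ} (ht : t ∈ Ioo (-η) (T + η))
    {x : EuclideanSpace ℝ (Fin 3)} (hx : meridian x ∉ closure U₁ ∪ closure U₂) :
    profileField v₁ v₂ a₁ a₂ Q₁ Q₂ t x = 0 := by
  rw [mem_union, not_or] at hx
  rw [profileField_apply, (h.slice₁ hA ht).swirlField_eq_zero hx.1,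
    (h.slice₂ hA ht).swirlField_eq_zero hx.2, add_zero]

/-- **Localisation over `Ū₁`**: near a point `x` with `R⁻¹x ∉ Ū₂` the field `u(t)` IS `u¹(t)`
(Scheffer (2.13)–(2.14): `u = uⁱ` on `R(Cᵢ)`). [cite: Scheffer1985, Lemma 2.1 (2.13)–(2.14)] -/
theorem profileField_eventuallyEq_left
    (h : IsNSIProfileData U₁ U₂ v₁ v₂ f₁ f₂ T τ z η δ C₁ C₂ a₁ a₂ Q₁ Q₂)
    (hA : IsNSIArrangement U₁ U₂ v₁ f₁ φ₁ v₂ f₂ φ₂ T τ z) {t : ℝ} (ht : t ∈ Ioo (-η) (T + η))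
    {x : EuclideanSpace ℝ (Fin 3)} (hx : meridian x ∉ closure U₂) :
    profileField v₁ v₂ a₁ a₂ Q₁ Q₂ t =ᶠ[𝓝 x] swirlField (a₁ t • v₁) (Q₁ t) := by
  have hO : IsOpen (revolve (closure U₂))ᶜ :=
    (isClosed_closure.preimage continuous_meridian).isOpen_compl
  filter_upwards [hO.mem_nhds hx] with y hy
  rw [profileField_apply, (h.slice₂ hA ht).swirlField_eq_zero hy, add_zero]

/-- **Localisation over `Ū₂`**: near a point `x` with `R⁻¹x ∉ Ū₁` the field `u(t)` is `u²(t)`.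
[cite: Scheffer1985, Lemma 2.1 (2.13)–(2.14)] -/
theorem profileField_eventuallyEq_right
    (h : IsNSIProfileData U₁ U₂ v₁ v₂ f₁ f₂ T τ z η δ C₁ C₂ a₁ a₂ Q₁ Q₂)
    (hA : IsNSIArrangement U₁ U₂ v₁ f₁ φ₁ v₂ f₂ φ₂ T τ z) {t : ℝ} (ht : t ∈ Ioo (-η) (T + η))
    {x : EuclideanSpace ℝ (Fin 3)} (hx : meridian x ∉ closure U₁) :
    profileField v₁ v₂ a₁ a₂ Q₁ Q₂ t =ᶠ[𝓝 x] swirlField (a₂ t • v₂) (Q₂ t) := by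
  have hO : IsOpen (revolve (closure U₁))ᶜ :=
    (isClosed_closure.preimage continuous_meridian).isOpen_compl
  filter_upwards [hO.mem_nhds hx] with y hy
  rw [profileField_apply, (h.slice₁ hA ht).swirlField_eq_zero hy, zero_add]

/-- At a point over `Ū₁`, `u(x,t) = u¹(x,t)`. [cite: Scheffer1985, Lemma 2.1 (2.14)] -/
theorem profileField_eq_left (h : IsNSIProfileData U₁ U₂ v₁ v₂ f₁ f₂ T τ z η δ C₁ C₂ a₁ a₂ Q₁ Q₂)
    (hA : IsNSIArrangement U₁ U₂ v₁ f₁ φ₁ v₂ f₂ φ₂ T τ z) {t : ℝ} (ht : t ∈ Ioo (-η) (T + η))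
    {x : EuclideanSpace ℝ (Fin 3)} (hx : meridian x ∉ closure U₂) :
    profileField v₁ v₂ a₁ a₂ Q₁ Q₂ t x = swirlField (a₁ t • v₁) (Q₁ t) x :=
  (h.profileField_eventuallyEq_left hA ht hx).self_of_nhds

/-- At a point over `Ū₂`, `u(x,t) = u²(x,t)`. [cite: Scheffer1985, Lemma 2.1 (2.14)] -/
theorem profileField_eq_right (h : IsNSIProfileData U₁ U₂ v₁ v₂ f₁ f₂ T τ z η δ C₁ C₂ a₁ a₂ Q₁ Q₂)
    (hA : IsNSIArrangement U₁ U₂ v₁ f₁ φ₁ v₂ f₂ φ₂ T τ z) {t : ℝ} (ht : t ∈ Ioo (-η) (T + η))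
    {x : EuclideanSpace ℝ (Fin 3)} (hx : meridian x ∉ closure U₁) :
    profileField v₁ v₂ a₁ a₂ Q₁ Q₂ t x = swirlField (a₂ t • v₂) (Q₂ t) x :=
  (h.profileField_eventuallyEq_right hA ht hx).self_of_nhds

/-! ### Divergence, gain, non-triviality -/

/-- **`div u(t) = 0`** for `t ∈ J` (Ożański Lemma 3.1 (i) for each summand; Scheffer (2.24)).
[cite: Ozanski2017NSISingular, Lemma 3.1 (i)] [cite: Scheffer1985, Lemma 2.1 (2.24)] -/
theorem isDivFree_profileField (h : IsNSIProfileData U₁ U₂ v₁ v₂ f₁ f₂ T τ z η δ C₁ C₂ a₁ a₂ Q₁ Q₂)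
    (hA : IsNSIArrangement U₁ U₂ v₁ f₁ φ₁ v₂ f₂ φ₂ T τ z) {t : ℝ} (ht : t ∈ Ioo (-η) (T + η)) :
    VectorCalculus.IsDivFree (profileField v₁ v₂ a₁ a₂ Q₁ Q₂ t) := by
  intro x
  have hd₁ := ((h.slice₁ hA ht).contDiff_swirlField.differentiable (by simp)) x
  have hd₂ := ((h.slice₂ hA ht).contDiff_swirlField.differentiable (by simp)) x
  have e : profileField v₁ v₂ a₁ a₂ Q₁ Q₂ t =
      fun y => swirlField (a₁ t • v₁) (Q₁ t) y + swirlField (a₂ t • v₂) (Q₂ t) y := rfl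
  rw [e, divergence_add_apply hd₁ hd₂, (h.slice₁ hA ht).isDivFree_swirlField x,
    (h.slice₂ hA ht).isDivFree_swirlField x, add_zero]

/-- **The gain (2.2) of a block**: `τ⁻¹|u(x,0)| ≤ |u(τx + z, T)|` for every `x ∈ ℝ³` (on `G`
from the profile gain and `|u| = (Q₁ + Q₂) ∘ R⁻¹`; off `G`, `u(x,0) = 0`).
[cite: Ozanski2017NSISingular, §4 (4.11) and Prop. 4.2 (ii)]
[cite: Scheffer1985, Lemma 3.1 (3.14)] -/
theorem gain_profileField (h : IsNSIProfileData U₁ U₂ v₁ v₂ f₁ f₂ T τ z η δ C₁ C₂ a₁ a₂ Q₁ Q₂)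
    (hA : IsNSIArrangement U₁ U₂ v₁ f₁ φ₁ v₂ f₂ φ₂ T τ z) (x : EuclideanSpace ℝ (Fin 3)) :
    τ⁻¹ * ‖profileField v₁ v₂ a₁ a₂ Q₁ Q₂ 0 x‖ ≤
      ‖profileField v₁ v₂ a₁ a₂ Q₁ Q₂ T (τ • x + z)‖ := by
  by_cases hx : x ∈ revolve (closure U₁ ∪ closure U₂)
  · rw [h.norm_profileField hA (h.zero_mem hA), h.norm_profileField hA (h.T_mem hA)]
    exact h.gain x hx
  · rw [h.profileField_eq_zero hA (h.zero_mem hA) (by simpa using hx), norm_zero, mul_zero]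
    exact norm_nonneg _

/-- **`u(·,0) ≢ 0`**: at the meridian point of any `q ∈ U₁`, `|u(·,0)| ≥ Q₁(0)(q) > 0`
(Scheffer, Lemma 2.3: `f₁ ≠ 0`; here `U₁ ≠ ∅` is part of the arrangement).
[cite: Scheffer1985, Lemma 2.3] -/
theorem exists_profileField_zero_ne_zero
    (h : IsNSIProfileData U₁ U₂ v₁ v₂ f₁ f₂ T τ z η δ C₁ C₂ a₁ a₂ Q₁ Q₂)
    (hA : IsNSIArrangement U₁ U₂ v₁ f₁ φ₁ v₂ f₂ φ₂ T τ z) :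
    ∃ x : EuclideanSpace ℝ (Fin 3), profileField v₁ v₂ a₁ a₂ Q₁ Q₂ 0 x ≠ 0 := by
  obtain ⟨q, hq⟩ := hA.nonempty
  refine ⟨meridianPoint q, fun h0 => ?_⟩
  have hqm : meridian (meridianPoint q) = q :=
    meridian_meridianPoint (le_of_lt (hA.structure₁.subset_halfPlane hq))
  have hn := congrArg (fun w : EuclideanSpace ℝ (Fin 3) => ‖w‖) h0
  simp only [norm_zero] at hn
  rw [h.norm_profileField hA (h.zero_mem hA), hqm] at hn
  have h1 := h.Q₁_pos (h.zero_mem hA) hq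
  have h2 := h.Q₂_nonneg 0 (h.zero_mem hA) q
  linarith

/-! ### The time derivative of `|u|²` -/

/-- Each time line `s ↦ Q₁(s)(q)` is differentiable at `t ∈ J`. [folklore] -/
theorem hasDerivAt_Q₁ (h : IsNSIProfileData U₁ U₂ v₁ v₂ f₁ f₂ T τ z η δ C₁ C₂ a₁ a₂ Q₁ Q₂)
    {t : ℝ} (ht : t ∈ Ioo (-η) (T + η)) (q : ℝ × ℝ) :
    DifferentiableAt ℝ (fun s => Q₁ s q) t :=
  ((IsSmoothSpaceTimeOn.hasDerivWithinAt_time h.Q₁_smooth ht q).hasDerivAt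
    (Ioo_mem_nhds ht.1 ht.2)).differentiableAt

/-- Each time line `s ↦ Q₂(s)(q)` is differentiable at `t ∈ J`. [folklore] -/
theorem hasDerivAt_Q₂ (h : IsNSIProfileData U₁ U₂ v₁ v₂ f₁ f₂ T τ z η δ C₁ C₂ a₁ a₂ Q₁ Q₂)
    {t : ℝ} (ht : t ∈ Ioo (-η) (T + η)) (q : ℝ × ℝ) :
    DifferentiableAt ℝ (fun s => Q₂ s q) t :=
  ((IsSmoothSpaceTimeOn.hasDerivWithinAt_time h.Q₂_smooth ht q).hasDerivAt
    (Ioo_mem_nhds ht.1 ht.2)).differentiableAt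

/-- **`∂ₜ|u|²(x,t) = ∂ₜ(Q₁²)(t, R⁻¹x) + ∂ₜ(Q₂²)(t, R⁻¹x)`** for `t ∈ J` (Scheffer (2.23); Ożański
§4.2: at points of `R(Uᵢ)` "the NSI becomes `∂ₜ qᵢ² ≤ …`").
[cite: Scheffer1985, Lemma 2.1 (2.23)] [cite: Ozanski2017NSISingular, §4.2 (Cases 1–2)] -/
theorem timeDeriv_norm_sq_profileField
    (h : IsNSIProfileData U₁ U₂ v₁ v₂ f₁ f₂ T τ z η δ C₁ C₂ a₁ a₂ Q₁ Q₂)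
    (hA : IsNSIArrangement U₁ U₂ v₁ f₁ φ₁ v₂ f₂ φ₂ T τ z) {t : ℝ} (ht : t ∈ Ioo (-η) (T + η))
    (x : EuclideanSpace ℝ (Fin 3)) :
    timeDeriv (fun s y => ‖profileField v₁ v₂ a₁ a₂ Q₁ Q₂ s y‖ ^ 2) t x =
      deriv (fun s => Q₁ s (meridian x) ^ 2) t + deriv (fun s => Q₂ s (meridian x) ^ 2) t := by
  rw [timeDeriv_apply]
  have he : (fun s => ‖profileField v₁ v₂ a₁ a₂ Q₁ Q₂ s x‖ ^ 2) =ᶠ[𝓝 t]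
      fun s => Q₁ s (meridian x) ^ 2 + Q₂ s (meridian x) ^ 2 := by
    filter_upwards [Ioo_mem_nhds ht.1 ht.2] with s hs
    exact h.norm_sq_profileField hA hs x
  rw [he.deriv_eq]
  exact deriv_add ((h.hasDerivAt_Q₁ ht _).pow 2) ((h.hasDerivAt_Q₂ ht _).pow 2)

/-- Off `Ū₁` the first profile is frozen: `∂ₜ(Q₁²)(t,q) = 0` for `q ∉ Ū₁`, `t ∈ J`.
[cite: Scheffer1985, Lemma 2.1 (2.4)] -/
theorem deriv_Q₁_sq_eq_zero (h : IsNSIProfileData U₁ U₂ v₁ v₂ f₁ f₂ T τ z η δ C₁ C₂ a₁ a₂ Q₁ Q₂)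
    {t : ℝ} (ht : t ∈ Ioo (-η) (T + η)) {q : ℝ × ℝ} (hq : q ∉ closure U₁) :
    deriv (fun s => Q₁ s q ^ 2) t = 0 := by
  have he : (fun s => Q₁ s q ^ 2) =ᶠ[𝓝 t] fun _ => (0 : ℝ) := by
    filter_upwards [Ioo_mem_nhds ht.1 ht.2] with s hs
    rw [h.Q₁_eq_zero s hs q hq]
    simp
  rw [he.deriv_eq, deriv_const]

/-- Off `Ū₂` the second profile is frozen: `∂ₜ(Q₂²)(t,q) = 0` for `q ∉ Ū₂`, `t ∈ J`.
[cite: Scheffer1985, Lemma 2.1 (2.4)] -/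
theorem deriv_Q₂_sq_eq_zero (h : IsNSIProfileData U₁ U₂ v₁ v₂ f₁ f₂ T τ z η δ C₁ C₂ a₁ a₂ Q₁ Q₂)
    {t : ℝ} (ht : t ∈ Ioo (-η) (T + η)) {q : ℝ × ℝ} (hq : q ∉ closure U₂) :
    deriv (fun s => Q₂ s q ^ 2) t = 0 := by
  have he : (fun s => Q₂ s q ^ 2) =ᶠ[𝓝 t] fun _ => (0 : ℝ) := by
    filter_upwards [Ioo_mem_nhds ht.1 ht.2] with s hs
    rw [h.Q₂_eq_zero s hs q hq]
    simp
  rw [he.deriv_eq, deriv_const]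

/-- Off `G` the energy density is frozen: `∂ₜ|u|²(x,t) = 0` for `R⁻¹x ∉ Ū₁ ∪ Ū₂`, `t ∈ J`.
[cite: Scheffer1985, Lemma 2.1 (2.12)] -/
theorem timeDeriv_norm_sq_profileField_eq_zero
    (h : IsNSIProfileData U₁ U₂ v₁ v₂ f₁ f₂ T τ z η δ C₁ C₂ a₁ a₂ Q₁ Q₂)
    (hA : IsNSIArrangement U₁ U₂ v₁ f₁ φ₁ v₂ f₂ φ₂ T τ z) {t : ℝ} (ht : t ∈ Ioo (-η) (T + η))
    {x : EuclideanSpace ℝ (Fin 3)} (hx : meridian x ∉ closure U₁ ∪ closure U₂) :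
    timeDeriv (fun s y => ‖profileField v₁ v₂ a₁ a₂ Q₁ Q₂ s y‖ ^ 2) t x = 0 := by
  rw [mem_union, not_or] at hx
  rw [h.timeDeriv_norm_sq_profileField hA ht, h.deriv_Q₁_sq_eq_zero ht hx.1,
    h.deriv_Q₂_sq_eq_zero ht hx.2, add_zero]

end IsNSIProfileData

end Literature.Barriers.NavierStokesRegularity
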